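import Literature.MathematicalPhysics.QuantumFieldTheory.Wightman
import Literature.Analysis.FunctionSpaces.WightmanFunctions
import Mathlib.Analysis.SpecialFunctions.Trigonometric.DerivHyp
import Mathlib.Analysis.SpecialFunctions.Arsinh
import Mathlib.Analysis.InnerProductSpace.Projection.Reflection
import Mathlib.LinearAlgebra.Matrix.BilinearForm
import Mathlib.MeasureTheory.Measure.Lebesgue.EqHaar
import Mathlib.MeasureTheory.Measure.Haar.InnerProductSpace
import Mathlib.Topology.Connected.LocallyConnected
import HarnessLib

/-!
# Lorentz invariance of the OS boundary values from Euclidean covariance (E1)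

Worker file for the discharge of the named fact `Literature.MathematicalPhysics.QuantumFieldTheory.OS1973_lorentzInvariant`
(`Literature.MathematicalPhysics.QuantumFieldTheory.WightmanProofs`, conjunct (A₃, R1) of the
decomposition of `os_reconstruction`): Osterwalder–Schrader I (1973), §4.2 "Lorentz Covariance
and Spectrum Condition" derive the invariance of the Wightman distributions `𝒲ₙ` under the
restricted Lorentz group from the Euclidean rotation invariance (4.2) of the Schwinger functions
through the infinitesimal generators (4.14)–(4.15). Here the same implication is proved by
analytic continuation in the group parameter instead (Streater–Wightman (1964), §2-4, complex
Lorentz transformations), which needs no differentiation of distributions: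

* **Geometry** (`LorentzGeometry`): orthochronous Lorentz transformations preserve `V₊`, the base
  cone and the forward tube `𝒯ₙ` (`lorentzActC_mem_forwardTube_of_orthochronous`, discharging the
  prelude fact `lorentzActC_mem_forwardTube` as `lorentzActC_mem_forwardTube_holds`), are
  unimodular (`abs_det_eq_one_of_mem_lorentzGroup`, from `Λᵀ η Λ = η`) and hence preserve
  Lebesgue measure.
* **Tube invariance ⇒ invariance of boundary values**
  (`HasDistributionalBoundaryValue.apply_eq_of_tubeInvariant`): if `𝔚 ∘ Λ_ℂ = 𝔚` on `𝒯ₙ` then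
  the distributional boundary value `T` satisfies `T(F ∘ Λ⁻¹) = T(F)` (change of variables in the
  approximating integrals, the base direction `η` is transported to `Λ⁻¹η`).
* **Spatial rotations** (`tubeInvariant_spatialRotation`): for `Λ = (1 ⊕ R)`, `R ∈ O(d)`,
  `Λ_ℂ` maps Euclidean points to Euclidean points, so E1 and the identity theorem on the tube
  from Euclidean points (`eqOn_forwardTube_of_euclidean`) give `𝔚 ∘ Λ_ℂ = 𝔚`.
* **Boosts** (`tubeInvariant_boost`): the complex boost `B_i(w)` of complex rapidity `w`
  (`boostC`) is the real boost for `w = χ` and the Euclidean rotation by `φ` in the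
  `(0, i)`-plane at Euclidean points for `w = iφ` (`boostC_mul_I_euclideanPoint`). For a
  time-ordered Euclidean point `z = ιx`, E1 gives `𝔚(B_i(iφ) z) = 𝔚(z)` for `φ` near `0`
  (`apply_euclideanPoint_planeRot_eq`: equality of Euclidean integrals over the open set where
  both `x` and its rotation are time-ordered), the function `w ↦ 𝔚(B_i(w) z)` is holomorphic on a
  strip `|Im w| < δ` (convex, contains `ℝ`), so the one-variable identity theorem gives
  `𝔚(B_i(χ) z) = 𝔚(z)` for all real `χ`; the identity theorem on the tube finishes.
* **Decomposition** (`exists_eq_spatialRotation_mul_boost_mul`): every orthochronous Lorentz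
  transformation is `(1 ⊕ R₁) B_i(χ) (1 ⊕ R₂)` with `R₁, R₂ ∈ O(d)` (`R₁` a reflection taking
  `eᵢ` to the direction of the spatial part of `Λe₀`, `sinh χ = ‖(Λe₀)⃗‖`; a Lorentz
  transformation fixing `e₀` is `1 ⊕ R₂`), hence `𝔚 ∘ Λ_ℂ = 𝔚` on `𝒯ₙ` for all of `L↑`
  (`tubeInvariant_of_orthochronous`) and the boundary values are invariant
  (`HasDistributionalBoundaryValue.lorentz_eq`, `.poincareTestMulti_inr_eq`).

The assembly into `OS1973_lorentzInvariant_holds` (5 lines on top of `IsOSContinuationFamily`)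
belongs to `WightmanProofs`, which imports this file.

## References
* K. Osterwalder, R. Schrader, Axioms for Euclidean Green's functions, CMP 31 (1973), §4.2.
* R. F. Streater, A. S. Wightman, PCT, Spin and Statistics, and All That (1964), §1-1, §1-3,
  §2-4.
-/

noncomputable section

open MeasureTheory Filter Topology Complex
open scoped SchwartzMap
open Literature.MathematicalPhysics.QuantumLattice Literature.MathematicalPhysics.QuantumFieldTheory

namespace Literature.MathematicalPhysics.QuantumFieldTheory

variable {d n : ℕ}

/-! ## Lorentz geometry: cone and tube invariance, unimodularity -/

section LorentzGeometry

variable {Λ : SpaceTime d ≃L[ℝ] SpaceTime d}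

/-- An orthochronous Lorentz transformation maps the open forward cone into itself:
`(Λ p)⁰ = η(Λ p, e₀) = η(p, Λ⁻¹ e₀) > 0` for `p, Λ⁻¹ e₀ ∈ V₊`, and `η(Λp, Λp) = η(p, p) > 0`
(Streater–Wightman (1964), §1-1). [cite: StreaterWightman1964, §1-1] -/
theorem apply_mem_forwardCone (hΛ : Λ ∈ lorentzGroup d) (ho : IsOrthochronous Λ) {p : SpaceTime d}
    (hp : p ∈ forwardCone d) : Λ p ∈ forwardCone d := by
  refine ⟨?_, ?_⟩
  · rw [← minkowskiForm_e₀_left, minkowskiForm_comm, minkowskiForm_apply_left_of_mem_lorentzGroup hΛ]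
    exact minkowskiForm_pos_of_mem_forwardCone hp
      (apply_e₀_mem_forwardCone ((lorentzGroup d).inv_mem hΛ) (ho.inv hΛ))
  · rw [hΛ]; exact hp.2

/-- An orthochronous Lorentz transformation maps the base cone of the forward tube into itself
(diagonal action). [folklore] -/
theorem tubeCone_lorentz (hΛ : Λ ∈ lorentzGroup d) (ho : IsOrthochronous Λ) {η : Fin n → SpaceTime d}
    (hη : η ∈ tubeCone d n) : (fun k => Λ (η k)) ∈ tubeCone d n := fun k => by
  rw [succDiff_map (fun v => Λ v) (fun a b => map_sub Λ a b)]
  exact apply_mem_forwardCone hΛ ho (hη k)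

/-- `Λ_ℂ` is additive. [folklore] -/
theorem lorentzActC_add (Λ : SpaceTime d ≃L[ℝ] SpaceTime d) (z w : Fin (d + 1) → ℂ) :
    lorentzActC Λ (z + w) = lorentzActC Λ z + lorentzActC Λ w := by
  ext μ
  simp only [lorentzActC, Pi.add_apply, Pi.smul_apply, complexifyPoint_apply, smul_eq_mul]
  have hre : rePart (z + w) = rePart z + rePart w := by ext ν; simp [rePart_apply]
  rw [hre, imPart_add, map_add, map_add]
  simp only [PiLp.add_apply]
  push_cast
  ring

/-- `Λ_ℂ` commutes with subtraction. [folklore] -/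
theorem lorentzActC_sub (Λ : SpaceTime d ≃L[ℝ] SpaceTime d) (z w : Fin (d + 1) → ℂ) :
    lorentzActC Λ (z - w) = lorentzActC Λ z - lorentzActC Λ w := by
  rw [sub_eq_add_neg, lorentzActC_add, sub_eq_add_neg]
  congr 1
  ext μ
  simp only [lorentzActC, Pi.add_apply, Pi.neg_apply, Pi.smul_apply, complexifyPoint_apply,
    smul_eq_mul]
  have hre : rePart (-w) = -rePart w := by ext ν; simp [rePart_apply]
  have him : imPart (-w) = -imPart w := by ext ν; simp [imPart_apply]
  rw [hre, him, map_neg, map_neg]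
  simp only [PiLp.neg_apply]
  push_cast
  ring

/-- **An orthochronous Lorentz transformation maps the forward tube into itself** (diagonal
complexified action; Streater–Wightman (1964), §2-4). This proves the prelude's named fact
`lorentzActC_mem_forwardTube` for all orthochronous `Λ ∈ L` (in particular for `L↑₊`). [cite: StreaterWightman1964, §2-4] -/
theorem lorentzActC_mem_forwardTube_of_orthochronous (hΛ : Λ ∈ lorentzGroup d) (ho : IsOrthochronous Λ)
    {z : Fin n → Fin (d + 1) → ℂ} (hz : z ∈ forwardTube d n) :
    (fun k => lorentzActC Λ (z k)) ∈ forwardTube d n := fun k => by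
  rw [succDiff_map (lorentzActC Λ) (lorentzActC_sub Λ), imPart_lorentzActC]
  exact apply_mem_forwardCone hΛ ho (hz k)

/-- **Discharge of the prelude fact `lorentzActC_mem_forwardTube`** (restricted Lorentz
transformations preserve the forward tube). [cite: StreaterWightman1964, §2-4] -/
theorem lorentzActC_mem_forwardTube_holds : lorentzActC_mem_forwardTube (d := d) (n := n) :=
  fun Λ _ hz =>
    lorentzActC_mem_forwardTube_of_orthochronous (restrictedLorentzGroup_le_lorentzGroup Λ.2)
      ((mem_restrictedLorentzGroup_iff _).1 Λ.2).2.1 hz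

/-- Coordinates of a linear map of space-time: `(Λ x) μ = ∑_ν x ν · (Λ e_ν) μ`. [folklore] -/
theorem apply_eq_sum_matrix (Λ : SpaceTime d ≃L[ℝ] SpaceTime d) (x : SpaceTime d) (μ : Fin (d + 1)) :
    Λ x μ = ∑ ν, x ν * Λ (EuclideanSpace.single ν 1) μ := by
  conv_lhs => rw [← (EuclideanSpace.basisFun (Fin (d + 1)) ℝ).sum_repr x]
  simp only [EuclideanSpace.basisFun_repr, EuclideanSpace.basisFun_apply, map_sum, map_smul]
  rw [WithLp.ofLp_sum, Finset.sum_apply]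
  simp

/-- **Matrix form of the complexified action**: `(Λ_ℂ z) μ = ∑_ν (Λ e_ν) μ · z ν`. [folklore] -/
theorem lorentzActC_apply_eq_sum (Λ : SpaceTime d ≃L[ℝ] SpaceTime d) (z : Fin (d + 1) → ℂ)
    (μ : Fin (d + 1)) :
    lorentzActC Λ z μ = ∑ ν, (Λ (EuclideanSpace.single ν 1) μ : ℂ) * z ν := by
  simp only [lorentzActC, Pi.add_apply, Pi.smul_apply, complexifyPoint_apply, smul_eq_mul,
    apply_eq_sum_matrix Λ (rePart z), apply_eq_sum_matrix Λ (imPart z), rePart_apply, imPart_apply]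
  push_cast
  rw [Finset.mul_sum, ← Finset.sum_add_distrib]
  refine Finset.sum_congr rfl fun ν _ => ?_
  conv_rhs => rw [← Complex.re_add_im (z ν)]
  ring

/-- The complexified action is complex differentiable (it is complex linear). [folklore] -/
theorem differentiable_lorentzActC (Λ : SpaceTime d ≃L[ℝ] SpaceTime d) :
    Differentiable ℂ (lorentzActC Λ) := by
  have : lorentzActC Λ = fun z μ => ∑ ν, (Λ (EuclideanSpace.single ν 1) μ : ℂ) * z ν := by
    funext z μ; exact lorentzActC_apply_eq_sum Λ z μ
  rw [this]
  exact differentiable_pi.2 fun μ =>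
    Differentiable.fun_sum fun ν _ => (differentiable_const _).mul (differentiable_apply ν)

/-- The diagonal complexified action is complex differentiable. [folklore] -/
theorem differentiable_lorentzActC_diag (Λ : SpaceTime d ≃L[ℝ] SpaceTime d) :
    Differentiable ℂ fun z : Fin n → Fin (d + 1) → ℂ => fun k => lorentzActC Λ (z k) :=
  differentiable_pi.2 fun k => (differentiable_lorentzActC Λ).comp (differentiable_apply k)

/-- The complexified action on a ray: `Λ_ℂ (x + i t η) = Λ x + i t Λ η`. [folklore] -/
theorem lorentzActC_ray (Λ : SpaceTime d ≃L[ℝ] SpaceTime d) (x η : SpaceTime d) (t : ℝ) :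
    lorentzActC Λ (complexifyPoint x + ((t : ℂ) * I) • complexifyPoint η) =
      complexifyPoint (Λ x) + ((t : ℂ) * I) • complexifyPoint (Λ η) := by
  have hre : rePart (complexifyPoint x + ((t : ℂ) * I) • complexifyPoint η) = x := by
    ext μ; simp [rePart_apply]
  rw [lorentzActC, hre, imPart_complexifyPoint_add_smul, map_smul]
  ext μ
  simp only [Pi.add_apply, Pi.smul_apply, complexifyPoint_apply, smul_eq_mul, PiLp.smul_apply]
  push_cast
  ring

/-- The complexified action on a real point. [folklore] -/
theorem lorentzActC_complexifyPoint (Λ : SpaceTime d ≃L[ℝ] SpaceTime d) (x : SpaceTime d) :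
    lorentzActC Λ (complexifyPoint x) = complexifyPoint (Λ x) := by
  have := lorentzActC_ray Λ x 0 0
  simpa using this

/-- Composition of complexified actions. [folklore] -/
theorem lorentzActC_mul (Λ Λ' : SpaceTime d ≃L[ℝ] SpaceTime d) (z : Fin (d + 1) → ℂ) :
    lorentzActC (Λ * Λ') z = lorentzActC Λ (lorentzActC Λ' z) := by
  simp only [lorentzActC, continuousLinearEquiv_mul_apply]
  have hre : rePart (complexifyPoint (Λ' (rePart z)) + (I : ℂ) • complexifyPoint (Λ' (imPart z))) =
      Λ' (rePart z) := by ext μ; simp [rePart_apply]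
  have him : imPart (complexifyPoint (Λ' (rePart z)) + (I : ℂ) • complexifyPoint (Λ' (imPart z))) =
      Λ' (imPart z) := by ext μ; simp [imPart_apply]
  rw [hre, him]

/-- The identity acts trivially. [folklore] -/
@[simp]
theorem lorentzActC_one (z : Fin (d + 1) → ℂ) : lorentzActC (1 : SpaceTime d ≃L[ℝ] SpaceTime d) z = z := by
  ext μ
  simp only [lorentzActC, continuousLinearEquiv_one_apply, Pi.add_apply, Pi.smul_apply,
    complexifyPoint_apply, rePart_apply, imPart_apply, smul_eq_mul]
  rw [mul_comm]; exact Complex.re_add_im (z μ)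

/-! ### Unimodularity and measure preservation -/

variable (d) in
/-- The Minkowski form as a Mathlib bilinear form. [folklore] -/
def minkowskiBilin : LinearMap.BilinForm ℝ (SpaceTime d) :=
  LinearMap.mk₂ ℝ (fun x y => minkowskiForm d x y) (fun x x' y => by simp only [map_add]; rfl)
    (fun c x y => by simp only [map_smul]; rfl) (fun x y y' => by simp only [map_add])
    (fun c x y => by simp only [map_smul])

/-- `minkowskiBilin d x y = minkowskiForm d x y`. [folklore] -/
@[simp]
theorem minkowskiBilin_apply (x y : SpaceTime d) : minkowskiBilin d x y = minkowskiForm d x y := rfl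

/-- The time-reversed vector pairs positively with `x`: `η(x, θx) = ∑_μ (x μ)²`. [folklore] -/
theorem minkowskiForm_timeReversed (x : SpaceTime d) :
    minkowskiForm d x (WithLp.toLp 2 fun μ => if μ = 0 then x 0 else -x μ) = ∑ μ, x μ * x μ := by
  rw [minkowskiForm_apply, Fin.sum_univ_succ]
  simp [Fin.succ_ne_zero]

/-- The Minkowski form is nondegenerate. [folklore] -/
theorem minkowskiBilin_nondegenerate : (minkowskiBilin d).Nondegenerate := by
  have key : ∀ x : SpaceTime d, (∑ μ, x μ * x μ = 0) → x = 0 := fun x hx => by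
    have h := (Finset.sum_eq_zero_iff_of_nonneg fun μ _ => mul_self_nonneg (x μ)).1 hx
    ext μ
    simpa using h μ (Finset.mem_univ μ)
  refine ⟨fun x hx => key x ?_, fun y hy => key y ?_⟩
  · rw [← minkowskiForm_timeReversed]; exact hx _
  · rw [← minkowskiForm_timeReversed, minkowskiForm_comm]; exact hy _

/-- **Lorentz transformations are unimodular**: `|det Λ| = 1` (from `Λᵀ η Λ = η` and
`det η ≠ 0`; Streater–Wightman (1964), §1-1, `det Λ = ±1`). [cite: StreaterWightman1964, §1-1] -/
theorem abs_det_eq_one_of_mem_lorentzGroup (hΛ : Λ ∈ lorentzGroup d) :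
    |LinearMap.det ((Λ : SpaceTime d →L[ℝ] SpaceTime d) : SpaceTime d →ₗ[ℝ] SpaceTime d)| = 1 := by
  classical
  set l : SpaceTime d →ₗ[ℝ] SpaceTime d := ((Λ : SpaceTime d →L[ℝ] SpaceTime d) : SpaceTime d →ₗ[ℝ] SpaceTime d)
  set b := (EuclideanSpace.basisFun (Fin (d + 1)) ℝ).toBasis
  have hcomp : (minkowskiBilin d).comp l l = minkowskiBilin d := by
    refine LinearMap.ext fun x => LinearMap.ext fun y => ?_
    exact hΛ x y
  have hmat := LinearMap.BilinForm.toMatrix_comp b b (minkowskiBilin d) l l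
  rw [hcomp] at hmat
  have hdet := congrArg Matrix.det hmat
  rw [Matrix.det_mul, Matrix.det_mul, Matrix.det_transpose, LinearMap.det_toMatrix] at hdet
  have hne : (LinearMap.BilinForm.toMatrix b (minkowskiBilin d)).det ≠ 0 :=
    (LinearMap.BilinForm.nondegenerate_iff_det_ne_zero b).1 minkowskiBilin_nondegenerate
  have hsq : LinearMap.det l ^ 2 = 1 := by
    have : (LinearMap.BilinForm.toMatrix b (minkowskiBilin d)).det * (LinearMap.det l ^ 2 - 1) = 0 := by
      linear_combination -hdet
    rcases mul_eq_zero.1 this with h | h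
    · exact absurd h hne
    · linarith
  have : |LinearMap.det l| ^ 2 = 1 := by rw [sq_abs, hsq]
  exact (pow_eq_one_iff_of_nonneg (abs_nonneg _) two_ne_zero).1 this

/-- **Lorentz transformations preserve Lebesgue measure** on space-time (`|det Λ| = 1`). [folklore] -/
theorem measurePreserving_of_mem_lorentzGroup (hΛ : Λ ∈ lorentzGroup d) :
    MeasurePreserving (Λ : SpaceTime d → SpaceTime d) := by
  set l : SpaceTime d →ₗ[ℝ] SpaceTime d := ((Λ : SpaceTime d →L[ℝ] SpaceTime d) : SpaceTime d →ₗ[ℝ] SpaceTime d)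
  have habs := abs_det_eq_one_of_mem_lorentzGroup hΛ
  have hdet : LinearMap.det l ≠ 0 := fun h => by
    have h1 : |LinearMap.det l| = 1 := habs
    rw [h, abs_zero] at h1
    exact zero_ne_one h1
  refine ⟨Λ.continuous.measurable, ?_⟩
  have hmap := Measure.map_linearMap_addHaar_eq_smul_addHaar (μ := (volume : Measure (SpaceTime d))) hdet
  rw [abs_inv, show |LinearMap.det l| = 1 from habs, inv_one, ENNReal.ofReal_one, one_smul] at hmap
  exact hmap

/-- The diagonal action of a Lorentz transformation preserves Lebesgue measure on
configurations. [folklore] -/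
theorem measurePreserving_lorentz_diag (hΛ : Λ ∈ lorentzGroup d) :
    MeasurePreserving fun x : Fin n → SpaceTime d => fun k => Λ (x k) :=
  volume_preserving_pi fun _ : Fin n => measurePreserving_of_mem_lorentzGroup hΛ

end LorentzGeometry


/-! ## Invariance of the continuation on the tube and of its boundary values -/

section TubeInvariance

variable {𝔚 : (Fin n → Fin (d + 1) → ℂ) → ℂ}

/-- `𝔚` is invariant on the forward tube under the diagonal complexified action of `Λ`. [folklore] -/
def TubeInvariant (𝔚 : (Fin n → Fin (d + 1) → ℂ) → ℂ) (Λ : SpaceTime d ≃L[ℝ] SpaceTime d) : Prop :=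
  ∀ z ∈ forwardTube d n, 𝔚 (fun k => lorentzActC Λ (z k)) = 𝔚 z

/-- Tube invariance is multiplicative (the second factor must preserve the tube). [folklore] -/
theorem TubeInvariant.mul {Λ Λ' : SpaceTime d ≃L[ℝ] SpaceTime d} (h : TubeInvariant 𝔚 Λ)
    (h' : TubeInvariant 𝔚 Λ') (hΛ' : Λ' ∈ lorentzGroup d) (ho' : IsOrthochronous Λ') :
    TubeInvariant 𝔚 (Λ * Λ') := fun z hz => by
  have : (fun k => lorentzActC (Λ * Λ') (z k)) =
      fun k => lorentzActC Λ ((fun j => lorentzActC Λ' (z j)) k) := by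
    funext k; exact lorentzActC_mul Λ Λ' (z k)
  rw [this, h _ (lorentzActC_mem_forwardTube_of_orthochronous hΛ' ho' hz), h' z hz]

/-- **From Euclidean points to the tube**: if `𝔚 (Λ_ℂ ιx) = 𝔚 (ιx)` at all time-ordered
Euclidean points and `Λ` preserves the tube, then `𝔚 ∘ Λ_ℂ = 𝔚` on `𝒯ₙ` (identity theorem
from Euclidean points, `eqOn_forwardTube_of_euclidean`). [folklore] -/
theorem tubeInvariant_of_euclidean {Λ : SpaceTime d ≃L[ℝ] SpaceTime d} (hΛ : Λ ∈ lorentzGroup d)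
    (ho : IsOrthochronous Λ) (h𝔚 : DifferentiableOn ℂ 𝔚 (forwardTube d n))
    (hE : ∀ x ∈ timeOrderedRegion d n,
      𝔚 (fun k => lorentzActC Λ (euclideanPoint x k)) = 𝔚 (euclideanPoint x)) :
    TubeInvariant 𝔚 Λ :=
  eqOn_forwardTube_of_euclidean
    (h𝔚.comp (differentiable_lorentzActC_diag Λ).differentiableOn
      fun _ hz => lorentzActC_mem_forwardTube_of_orthochronous hΛ ho hz) h𝔚 hE

/-- **Lorentz invariance of the boundary values from invariance on the tube**
(Osterwalder–Schrader I (1973), §4.2; Streater–Wightman (1964), Thm. 2-11 ff.): if `𝔚` is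
invariant on `𝒯ₙ` under `Λ_ℂ` for an orthochronous Lorentz transformation `Λ` and `T` is the
distributional boundary value of `𝔚`, then `T(F ∘ Λ⁻¹) = T(F)` (witness form: any Schwartz `G`
with `G(x) = F(Λ⁻¹ x₁, …, Λ⁻¹ xₙ)`). Proof: change of variables `x = Λ y` (`|det Λ| = 1`) in the
approximating integrals and `Λ_ℂ (y + i t Λ⁻¹η) = Λ y + i t η`. [cite: OsterwalderSchraderCMP1973, §4.2] -/
theorem _root_.Literature.MathematicalPhysics.QuantumLattice.HasDistributionalBoundaryValue.apply_eq_of_tubeInvariant {Λ : SpaceTime d ≃L[ℝ] SpaceTime d}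
    (hΛ : Λ ∈ lorentzGroup d) (ho : IsOrthochronous Λ) (hinv : TubeInvariant 𝔚 Λ)
    {T : 𝓢((Fin n → SpaceTime d), ℂ) →L[ℂ] ℂ} (hT : HasDistributionalBoundaryValue 𝔚 T)
    {F G : 𝓢((Fin n → SpaceTime d), ℂ)} (hG : ∀ x, G x = F fun k => Λ.symm (x k)) :
    T G = T F := by
  set η₀ : Fin n → SpaceTime d := fun k => (((k : ℕ) : ℝ) + 1) • e₀ d
  have hη₀ : η₀ ∈ tubeCone d n := stdDirection_mem_tubeCone
  have hΛi : Λ⁻¹ ∈ lorentzGroup d := (lorentzGroup d).inv_mem hΛ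
  have hoi : IsOrthochronous Λ⁻¹ := ho.inv hΛ
  set η' : Fin n → SpaceTime d := fun k => Λ⁻¹ (η₀ k)
  have hη' : η' ∈ tubeCone d n := tubeCone_lorentz hΛi hoi hη₀
  refine tendsto_nhds_unique_of_eventuallyEq (hT η₀ hη₀ G) (hT η' hη' F) ?_
  refine eventually_nhdsWithin_of_forall fun t (ht : 0 < t) => ?_
  -- change of variables `x = Λ y`
  have hmp := measurePreserving_lorentz_diag (n := n) hΛ
  set e : (Fin n → SpaceTime d) ≃ᵐ (Fin n → SpaceTime d) :=
    (lorentzDiag n Λ).toHomeomorph.toMeasurableEquiv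
  have he : MeasurePreserving e := hmp
  have := he.integral_comp' (fun x => 𝔚 (fun k => complexifyPoint (x k) +
    ((t : ℂ) * I) • complexifyPoint (η₀ k)) * G x)
  have he_apply : ∀ y, e y = fun k => Λ (y k) := fun y => rfl
  beta_reduce
  rw [← this]
  congr 1
  funext y
  rw [he_apply]
  have hray : (fun k => complexifyPoint (Λ (y k)) + ((t : ℂ) * I) • complexifyPoint (η₀ k)) =
      fun k => lorentzActC Λ (complexifyPoint (y k) + ((t : ℂ) * I) • complexifyPoint (η' k)) := by
    funext k
    rw [lorentzActC_ray]
    simp [η', continuousLinearEquiv_apply_inv_apply]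
  rw [hray, hinv _ (mem_forwardTube_of_mem_tubeCone y η' hη' ht), hG]
  congr 2
  funext k
  exact Λ.symm_apply_apply (y k)

end TubeInvariance

/-! ## Spatial rotations and reflections (from E1) -/

section Spatial

/-- A linear isometry `R` of space `ℝ^d` acting on Euclidean `ℝ^{d+1}` (= `SpaceTime d` as a
type) by `(x⁰, x⃗) ↦ (x⁰, R x⃗)`, as a linear isometry of `ℝ^{d+1}`
(the Euclidean counterpart of `spatialRotation`). [folklore] -/
def spatialIsometry (R : EuclideanSpace ℝ (Fin d) ≃ₗᵢ[ℝ] EuclideanSpace ℝ (Fin d)) :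
    EuclideanSpace ℝ (Fin (d + 1)) ≃ₗᵢ[ℝ] EuclideanSpace ℝ (Fin (d + 1)) :=
  LinearIsometryEquiv.mk (spatialRotation R.toContinuousLinearEquiv).toLinearEquiv fun x => by
    show ‖spatialRotation R.toContinuousLinearEquiv x‖ = ‖x‖
    rw [EuclideanSpace.norm_eq, EuclideanSpace.norm_eq]
    congr 1
    rw [Fin.sum_univ_succ, Fin.sum_univ_succ]
    have h := EuclideanSpace.norm_sq_eq (R (spaceC d x))
    rw [R.norm_map, EuclideanSpace.norm_sq_eq] at h
    simp only [spatialRotation_apply, ofTimeSpace_apply_zero, ofTimeSpace_apply_succ, timeC_apply]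
    simp only [spaceC_apply] at h
    simp only [LinearIsometryEquiv.coe_toContinuousLinearEquiv, ← h]

/-- `spatialIsometry R` acts as `spatialRotation R`. [folklore] -/
@[simp]
theorem spatialIsometry_apply (R : EuclideanSpace ℝ (Fin d) ≃ₗᵢ[ℝ] EuclideanSpace ℝ (Fin d))
    (x : EuclideanSpace ℝ (Fin (d + 1))) :
    spatialIsometry R x = spatialRotation R.toContinuousLinearEquiv x := rfl

/-- `spatialIsometry R` does not change the time coordinate. [folklore] -/
@[simp]
theorem spatialIsometry_apply_zero (R : EuclideanSpace ℝ (Fin d) ≃ₗᵢ[ℝ] EuclideanSpace ℝ (Fin d))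
    (x : EuclideanSpace ℝ (Fin (d + 1))) : spatialIsometry R x 0 = x 0 := by
  simp [timeC_apply]

/-- The inverse of `spatialIsometry R` does not change the time coordinate either. [folklore] -/
@[simp]
theorem spatialIsometry_symm_apply_zero (R : EuclideanSpace ℝ (Fin d) ≃ₗᵢ[ℝ] EuclideanSpace ℝ (Fin d))
    (y : EuclideanSpace ℝ (Fin (d + 1))) : (spatialIsometry R).symm y 0 = y 0 := by
  conv_rhs => rw [← (spatialIsometry R).apply_symm_apply y]
  rw [spatialIsometry_apply_zero]

/-- The spatial rotation embedding is orthochronous. [folklore] -/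
theorem isOrthochronous_spatialRotation (R : EuclideanSpace ℝ (Fin d) ≃L[ℝ] EuclideanSpace ℝ (Fin d)) :
    IsOrthochronous (spatialRotation R) := by
  simp [IsOrthochronous, timeC_apply, e₀]

/-- **Euclidean points are equivariant for spatial isometries**:
`Λ_ℂ (ι x)_k = ι(R̂ x)_k` for `Λ = spatialRotation R`, `R̂ = spatialIsometry R`. [folklore] -/
theorem lorentzActC_spatialRotation_euclideanPoint
    (R : EuclideanSpace ℝ (Fin d) ≃ₗᵢ[ℝ] EuclideanSpace ℝ (Fin d))
    (x : Fin n → EuclideanSpace ℝ (Fin (d + 1))) (k : Fin n) :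
    lorentzActC (spatialRotation R.toContinuousLinearEquiv) (euclideanPoint x k) =
      euclideanPoint (fun j => spatialIsometry R (x j)) k := by
  have hre : rePart (euclideanPoint x k) = ofTimeSpace 0 (spaceC d (x k)) := by
    ext μ; refine Fin.cases ?_ (fun i => ?_) μ <;> simp [rePart_apply, euclideanPoint]
  have him : imPart (euclideanPoint x k) = ofTimeSpace (x k 0) 0 := by
    ext μ; refine Fin.cases ?_ (fun i => ?_) μ <;> simp [Fin.succ_ne_zero]
  rw [lorentzActC, hre, him]
  ext μ
  refine Fin.cases ?_ (fun i => ?_) μ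
  · simp [timeC_apply]
  · simp [timeC_apply, euclideanPoint, Fin.succ_ne_zero]

/-- Spatial isometries preserve time-ordering of test functions. [folklore] -/
theorem _root_.Literature.MathematicalPhysics.QuantumLattice.IsTimeOrdered.linActMulti_spatialIsometry
    (R : EuclideanSpace ℝ (Fin d) ≃ₗᵢ[ℝ] EuclideanSpace ℝ (Fin d))
    {F : 𝓢((Fin n → EuclideanSpace ℝ (Fin (d + 1))), ℂ)} (hF : IsTimeOrdered F) :
    IsTimeOrdered (linActMulti (spatialIsometry R) F) := by
  intro x hx
  set e : (Fin n → EuclideanSpace ℝ (Fin (d + 1))) ≃ₜ (Fin n → EuclideanSpace ℝ (Fin (d + 1))) :=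
    (ContinuousLinearEquiv.piCongrRight fun _ : Fin n =>
      (spatialIsometry R).symm.toContinuousLinearEquiv).toHomeomorph
  have hcomp : ((linActMulti (spatialIsometry R) F : 𝓢(_, ℂ)) :
      (Fin n → EuclideanSpace ℝ (Fin (d + 1))) → ℂ) =
      (F : (Fin n → EuclideanSpace ℝ (Fin (d + 1))) → ℂ) ∘ e := by
    funext y; rfl
  rw [hcomp, tsupport_comp_eq_preimage] at hx
  obtain ⟨hpos, hmono⟩ := hF hx
  refine ⟨fun i => ?_, fun i j hij => ?_⟩
  · have := hpos i
    simpa [e] using this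
  · have := hmono hij
    simpa [e] using this

variable {S : SchwingerFamily (EuclideanSpace ℝ (Fin (d + 1)))} {𝔚 : (Fin n → Fin (d + 1) → ℂ) → ℂ}

/-- **Spatial rotations and reflections act trivially on the continuation** (E1 at Euclidean
points and the identity theorem on the tube): `𝔚 ∘ Λ_ℂ = 𝔚` on `𝒯ₙ` for
`Λ = spatialRotation R`, `R` any linear isometry of space. [cite: OsterwalderSchraderCMP1973, §4.2] -/
theorem tubeInvariant_spatialRotation (hE1 : S.IsEuclideanCovariant)
    (h𝔚 : DifferentiableOn ℂ 𝔚 (forwardTube d n))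
    (hS : ∀ F : 𝓢((Fin n → EuclideanSpace ℝ (Fin (d + 1))), ℂ), IsTimeOrdered F →
      S n F = ∫ x, 𝔚 (euclideanPoint x) * F x)
    (R : EuclideanSpace ℝ (Fin d) ≃ₗᵢ[ℝ] EuclideanSpace ℝ (Fin d)) :
    TubeInvariant 𝔚 (spatialRotation R.toContinuousLinearEquiv) := by
  have hΛ := spatialRotation_mem_lorentzGroup R
  have ho := isOrthochronous_spatialRotation R.toContinuousLinearEquiv
  refine tubeInvariant_of_euclidean hΛ ho h𝔚 ?_
  -- equality at Euclidean points from equality of Euclidean integrals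
  have hcont : ∀ {G : (Fin n → Fin (d + 1) → ℂ) → ℂ}, DifferentiableOn ℂ G (forwardTube d n) →
      ContinuousOn (fun x => G (euclideanPoint x)) (timeOrderedRegion d n) := fun hG =>
    hG.continuousOn.comp continuous_euclideanPoint.continuousOn
      mapsTo_euclideanPoint_timeOrderedRegion
  have hdiff : DifferentiableOn ℂ (fun z : Fin n → Fin (d + 1) → ℂ =>
      𝔚 (fun k => lorentzActC (spatialRotation R.toContinuousLinearEquiv) (z k))) (forwardTube d n) :=
    h𝔚.comp (differentiable_lorentzActC_diag _).differentiableOn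
      fun _ hz => lorentzActC_mem_forwardTube_of_orthochronous hΛ ho hz
  have key := eqOn_timeOrderedRegion_of_integral_eq (hcont hdiff) (hcont h𝔚) fun F hF => by
    -- `∫ 𝔚(Λ ιx) F x = ∫ 𝔚(ι(R̂x)) F x = ∫ 𝔚(ιy) F(R̂⁻¹ y) = 𝔖ₙ(F ∘ R̂⁻¹) = 𝔖ₙ(F)`
    simp only [lorentzActC_spatialRotation_euclideanPoint]
    have hmp : MeasurePreserving fun x : Fin n → EuclideanSpace ℝ (Fin (d + 1)) =>
        fun k => spatialIsometry R (x k) :=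
      volume_preserving_pi fun _ : Fin n => (spatialIsometry R).measurePreserving
    set e : (Fin n → EuclideanSpace ℝ (Fin (d + 1))) ≃ᵐ (Fin n → EuclideanSpace ℝ (Fin (d + 1))) :=
      (ContinuousLinearEquiv.piCongrRight fun _ : Fin n =>
        (spatialIsometry R).toContinuousLinearEquiv).toHomeomorph.toMeasurableEquiv
    have he : MeasurePreserving e := hmp
    have hcv := he.integral_comp'
      (fun y => 𝔚 (euclideanPoint y) * linActMulti (spatialIsometry R) F y)
    have he_apply : ∀ x, e x = fun k => spatialIsometry R (x k) := fun x => rfl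
    have hcv' : ∫ x, 𝔚 (euclideanPoint fun k => spatialIsometry R (x k)) * F x =
        ∫ y, 𝔚 (euclideanPoint y) * linActMulti (spatialIsometry R) F y := by
      rw [← hcv]
      congr 1
      funext x
      rw [he_apply, linActMulti_apply]
      simp only [LinearIsometryEquiv.symm_apply_apply]
    rw [hcv', ← hS _ (hF.linActMulti_spatialIsometry R), hE1.linActMulti, hS F hF]
  exact key

end Spatial


/-! ## Boosts: real, complex and imaginary rapidity -/

section Boost

/-- Boosts preserve the Minkowski form (`cosh² − sinh² = 1`; Streater–Wightman (1964), §1-3). [cite: StreaterWightman1964, §1-3] -/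
theorem boost_mem_lorentzGroup (i : Fin d) (χ : ℝ) : boost i χ ∈ lorentzGroup d := by
  intro x y
  have h := Real.cosh_sq χ
  rw [minkowskiForm_apply, minkowskiForm_apply, ← Finset.add_sum_erase _ _ (Finset.mem_univ i),
    ← Finset.add_sum_erase _ _ (Finset.mem_univ i)]
  have hrest : ∑ j ∈ Finset.univ.erase i, boost i χ x j.succ * boost i χ y j.succ =
      ∑ j ∈ Finset.univ.erase i, x j.succ * y j.succ := by
    refine Finset.sum_congr rfl fun j hj => ?_
    have hji : j ≠ i := Finset.ne_of_mem_erase hj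
    have : (j.succ : Fin (d + 1)) ≠ i.succ := fun h => hji (Fin.succ_injective _ h)
    simp [boostLin_apply, Fin.succ_ne_zero, this]
  rw [hrest]
  simp only [boost_apply, boostLin_apply, if_true, Fin.succ_ne_zero, if_false]
  linear_combination (x 0 * y 0 - x i.succ * y i.succ) * h

/-- Boosts are orthochronous: `(B e₀)⁰ = cosh χ > 0`. [folklore] -/
theorem isOrthochronous_boost (i : Fin d) (χ : ℝ) : IsOrthochronous (boost i χ) := by
  simp [IsOrthochronous, boostLin_apply, e₀, Real.cosh_pos]

/-- The **complex boost** of complex rapidity `w` in the `i`-th spatial direction acting on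
`ℂ^{1+d}`: `z⁰ ↦ cosh w z⁰ + sinh w zⁱ`, `zⁱ ↦ sinh w z⁰ + cosh w zⁱ`. For real `w = χ` it is
`Λ_ℂ` of `boost i χ` (`boostC_ofReal`); for imaginary `w = iφ` it maps Euclidean points to
Euclidean points rotated by `φ` in the `(0, i)`-plane (`boostC_mul_I_euclideanPoint`) — the
one-parameter bridge between E1 and Lorentz invariance (Osterwalder–Schrader I (1973), §4.2;
Streater–Wightman (1964), §2-4, complex Lorentz transformations). [cite: StreaterWightman1964, §2-4] -/
def boostC (i : Fin d) (w : ℂ) (z : Fin (d + 1) → ℂ) : Fin (d + 1) → ℂ := fun j =>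
  if j = 0 then Complex.cosh w * z 0 + Complex.sinh w * z i.succ
  else if j = i.succ then Complex.sinh w * z 0 + Complex.cosh w * z i.succ else z j

/-- Real rapidity: the complex boost is the complexified real boost. [folklore] -/
theorem boostC_ofReal (i : Fin d) (χ : ℝ) (z : Fin (d + 1) → ℂ) :
    boostC i (χ : ℂ) z = lorentzActC (boost i χ) z := by
  ext j
  simp only [boostC, lorentzActC, Pi.add_apply, Pi.smul_apply, complexifyPoint_apply, smul_eq_mul,
    boost_apply, boostLin_apply, rePart_apply, imPart_apply, ← Complex.ofReal_cosh, ← Complex.ofReal_sinh]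
  by_cases hj : j = 0
  · subst hj
    simp only [if_true]
    apply Complex.ext <;> simp
  · simp only [hj, if_false]
    by_cases hji : j = i.succ
    · subst hji
      simp only [if_true]
      apply Complex.ext <;> simp
    · simp only [hji, if_false]
      apply Complex.ext <;> simp

/-- Zero rapidity acts trivially. [folklore] -/
@[simp]
theorem boostC_zero (i : Fin d) (z : Fin (d + 1) → ℂ) : boostC i 0 z = z := by
  ext j
  by_cases hj : j = 0
  · subst hj; simp [boostC]
  · by_cases hji : j = i.succ
    · subst hji; simp [boostC, Fin.succ_ne_zero]
    · simp [boostC, hj, hji]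

/-- The complex boost is entire in the rapidity (for a fixed configuration). [folklore] -/
theorem differentiable_boostC_rapidity (i : Fin d) (z : Fin n → Fin (d + 1) → ℂ) :
    Differentiable ℂ fun w : ℂ => fun k => boostC i w (z k) := by
  refine differentiable_pi.2 fun k => differentiable_pi.2 fun j => ?_
  by_cases hj : j = 0
  · subst hj
    simp only [boostC, if_true]
    exact (Complex.differentiable_cosh.mul (differentiable_const _)).add
      (Complex.differentiable_sinh.mul (differentiable_const _))
  · by_cases hji : j = i.succ
    · subst hji
      simp only [boostC, Fin.succ_ne_zero, if_false, if_true]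
      exact (Complex.differentiable_sinh.mul (differentiable_const _)).add
        (Complex.differentiable_cosh.mul (differentiable_const _))
    · simp only [boostC, hj, hji, if_false]
      exact differentiable_const _

/-- The **Euclidean rotation in the `(0, i)`-plane** by the angle `φ`:
`x⁰ ↦ cos φ x⁰ + sin φ xⁱ`, `xⁱ ↦ −sin φ x⁰ + cos φ xⁱ` (underlying linear map). [folklore] -/
def planeRotLin (i : Fin d) (φ : ℝ) : EuclideanSpace ℝ (Fin (d + 1)) →ₗ[ℝ] EuclideanSpace ℝ (Fin (d + 1)) where
  toFun x := WithLp.toLp 2 fun j =>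
    if j = 0 then Real.cos φ * x 0 + Real.sin φ * x i.succ
    else if j = i.succ then -Real.sin φ * x 0 + Real.cos φ * x i.succ else x j
  map_add' x y := by
    ext j
    simp only [PiLp.add_apply]
    split_ifs <;> ring
  map_smul' c x := by
    ext j
    simp only [PiLp.smul_apply, smul_eq_mul, RingHom.id_apply]
    split_ifs <;> ring

/-- Coordinates of `planeRotLin`. [folklore] -/
@[simp]
theorem planeRotLin_apply (i : Fin d) (φ : ℝ) (x : EuclideanSpace ℝ (Fin (d + 1))) (j : Fin (d + 1)) :
    planeRotLin i φ x j =
      if j = 0 then Real.cos φ * x 0 + Real.sin φ * x i.succ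
      else if j = i.succ then -Real.sin φ * x 0 + Real.cos φ * x i.succ else x j := rfl

/-- `planeRotLin i (-φ)` is a left inverse of `planeRotLin i φ` (`cos² + sin² = 1`). [folklore] -/
theorem planeRotLin_neg_apply_planeRotLin (i : Fin d) (φ : ℝ) (x : EuclideanSpace ℝ (Fin (d + 1))) :
    planeRotLin i (-φ) (planeRotLin i φ x) = x := by
  have h := Real.cos_sq_add_sin_sq φ
  ext j
  simp only [planeRotLin_apply, Real.cos_neg, Real.sin_neg, if_true, Fin.succ_ne_zero, if_false]
  split_ifs with h0 hi
  · subst h0; linear_combination (x 0) * h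
  · subst hi; linear_combination (x i.succ) * h
  · rfl

/-- The plane rotation as a linear equivalence. [folklore] -/
def planeRotEquiv (i : Fin d) (φ : ℝ) : EuclideanSpace ℝ (Fin (d + 1)) ≃ₗ[ℝ] EuclideanSpace ℝ (Fin (d + 1)) :=
  { planeRotLin i φ with
    invFun := planeRotLin i (-φ)
    left_inv := planeRotLin_neg_apply_planeRotLin i φ
    right_inv := fun x => by simpa using planeRotLin_neg_apply_planeRotLin i (-φ) x }

/-- The **Euclidean rotation in the `(0, i)`-plane** as a linear isometry of `ℝ^{d+1}`. [folklore] -/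
def planeRot (i : Fin d) (φ : ℝ) : EuclideanSpace ℝ (Fin (d + 1)) ≃ₗᵢ[ℝ] EuclideanSpace ℝ (Fin (d + 1)) :=
  LinearIsometryEquiv.mk (planeRotEquiv i φ) fun x => by
    show ‖planeRotLin i φ x‖ = ‖x‖
    have h := Real.cos_sq_add_sin_sq φ
    rw [EuclideanSpace.norm_eq, EuclideanSpace.norm_eq]
    congr 1
    rw [Fin.sum_univ_succ, Fin.sum_univ_succ, ← Finset.add_sum_erase _ _ (Finset.mem_univ i),
      ← Finset.add_sum_erase _ (fun j => ‖x (Fin.succ j)‖ ^ 2) (Finset.mem_univ i)]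
    have hrest : ∑ j ∈ Finset.univ.erase i, ‖planeRotLin i φ x j.succ‖ ^ 2 =
        ∑ j ∈ Finset.univ.erase i, ‖x j.succ‖ ^ 2 := by
      refine Finset.sum_congr rfl fun j hj => ?_
      have hji : j ≠ i := Finset.ne_of_mem_erase hj
      have : (j.succ : Fin (d + 1)) ≠ i.succ := fun h => hji (Fin.succ_injective _ h)
      simp [Fin.succ_ne_zero, this]
    rw [hrest]
    simp only [planeRotLin_apply, if_true, Fin.succ_ne_zero, if_false, Real.norm_eq_abs, sq_abs]
    linear_combination ((x 0) ^ 2 + (x i.succ) ^ 2) * h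

/-- Coordinates of `planeRot`. [folklore] -/
@[simp]
theorem planeRot_apply (i : Fin d) (φ : ℝ) (x : EuclideanSpace ℝ (Fin (d + 1))) (j : Fin (d + 1)) :
    planeRot i φ x j =
      if j = 0 then Real.cos φ * x 0 + Real.sin φ * x i.succ
      else if j = i.succ then -Real.sin φ * x 0 + Real.cos φ * x i.succ else x j := rfl

/-- **Imaginary rapidity rotates Euclidean points**: `B_i(iφ) ι(x)_k = ι(R_φ x)_k` with the
Euclidean rotation `R_φ = planeRot i φ` (`cosh iφ = cos φ`, `sinh iφ = i sin φ`). [folklore] -/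
theorem boostC_mul_I_euclideanPoint (i : Fin d) (φ : ℝ) (x : Fin n → EuclideanSpace ℝ (Fin (d + 1)))
    (k : Fin n) :
    boostC i ((φ : ℂ) * I) (euclideanPoint x k) = euclideanPoint (fun j => planeRot i φ (x j)) k := by
  ext j
  simp only [boostC, Complex.cosh_mul_I, Complex.sinh_mul_I, ← Complex.ofReal_cos, ← Complex.ofReal_sin]
  by_cases hj : j = 0
  · subst hj
    simp only [if_true, euclideanPoint_apply_zero, planeRot_apply]
    rw [show euclideanPoint x k i.succ = (x k i.succ : ℂ) from euclideanPoint_apply_succ x k i]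
    push_cast
    ring
  · simp only [hj, if_false]
    by_cases hji : j = i.succ
    · subst hji
      simp only [if_true, euclideanPoint_apply_zero, euclideanPoint_apply_succ, planeRot_apply,
        Fin.succ_ne_zero, if_false]
      push_cast
      ring_nf
      rw [Complex.I_sq]
      ring
    · simp only [hji, if_false, euclideanPoint, hj, planeRot_apply]

/-- The plane rotation is jointly continuous in the angle and the configuration. [folklore] -/
theorem continuous_planeRot_diag (i : Fin d) :
    Continuous fun p : ℝ × (Fin n → EuclideanSpace ℝ (Fin (d + 1))) =>
      fun k => planeRot i p.1 (p.2 k) := by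
  refine continuous_pi fun k => ?_
  have hc : ∀ j : Fin (d + 1), Continuous fun p : ℝ × (Fin n → EuclideanSpace ℝ (Fin (d + 1))) =>
      p.2 k j := fun j =>
    (EuclideanSpace.proj j).continuous.comp ((continuous_apply k).comp continuous_snd)
  have hcos : Continuous fun p : ℝ × (Fin n → EuclideanSpace ℝ (Fin (d + 1))) => Real.cos p.1 :=
    Real.continuous_cos.comp continuous_fst
  have hsin : Continuous fun p : ℝ × (Fin n → EuclideanSpace ℝ (Fin (d + 1))) => Real.sin p.1 :=
    Real.continuous_sin.comp continuous_fst
  refine (PiLp.continuous_toLp 2 _).comp (continuous_pi fun j => ?_)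
  by_cases hj : j = 0
  · subst hj
    simp only [if_true]
    exact (hcos.mul (hc 0)).add (hsin.mul (hc _))
  · by_cases hji : j = i.succ
    · subst hji
      simp only [Fin.succ_ne_zero, if_false, if_true]
      exact (hsin.neg.mul (hc 0)).add (hcos.mul (hc _))
    · simp only [hj, hji, if_false]
      exact hc j

end Boost


/-! ## Boost invariance of the continuation from E1 -/

section BoostInvariance

/-- **Addition formula for complex boosts**: `B_i(w + w') = B_i(w) B_i(w')` (hyperbolic addition
formulas). [folklore] -/
theorem boostC_add (i : Fin d) (w w' : ℂ) (z : Fin (d + 1) → ℂ) :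
    boostC i (w + w') z = boostC i w (boostC i w' z) := by
  ext j
  by_cases hj : j = 0
  · subst hj
    simp only [boostC, if_true, Fin.succ_ne_zero, if_false, Complex.cosh_add, Complex.sinh_add]
    ring
  · by_cases hji : j = i.succ
    · subst hji
      simp only [boostC, Fin.succ_ne_zero, if_false, if_true, Complex.cosh_add, Complex.sinh_add]
      ring
    · simp only [boostC, hj, hji, if_false]

/-- The plane rotation by the angle `0` is the identity. [folklore] -/
@[simp]
theorem planeRot_zero_apply (i : Fin d) (x : EuclideanSpace ℝ (Fin (d + 1))) : planeRot i 0 x = x := by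
  ext j
  rw [planeRot_apply]
  split_ifs with h0 hi
  · subst h0; simp
  · subst hi; simp
  · rfl

/-- **Two functions continuous on an open set `U` of Euclidean configurations with equal
integrals against all compactly supported Schwartz functions supported in `U` agree on `U`**
(the open-set version of `eqOn_timeOrderedRegion_of_integral_eq`: smooth bump functions,
`IsOpen.ae_eq_zero_of_integral_contDiff_smul_eq_zero`, `Measure.eqOn_open_of_ae_eq`). [folklore] -/
theorem eqOn_of_integral_mul_eq_of_isOpen {U : Set (Fin n → EuclideanSpace ℝ (Fin (d + 1)))}
    (hU : IsOpen U) {G G' : (Fin n → EuclideanSpace ℝ (Fin (d + 1))) → ℂ}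
    (hG : ContinuousOn G U) (hG' : ContinuousOn G' U)
    (h : ∀ F : 𝓢((Fin n → EuclideanSpace ℝ (Fin (d + 1))), ℂ),
      tsupport (F : (Fin n → EuclideanSpace ℝ (Fin (d + 1))) → ℂ) ⊆ U →
      HasCompactSupport (F : (Fin n → EuclideanSpace ℝ (Fin (d + 1))) → ℂ) →
      ∫ x, G x * F x = ∫ x, G' x * F x) :
    Set.EqOn G G' U := by
  have hf : ContinuousOn (fun x => G x - G' x) U := hG.sub hG'
  have hae : ∀ᵐ x ∂(volume : Measure (Fin n → EuclideanSpace ℝ (Fin (d + 1)))),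
      x ∈ U → G x - G' x = 0 := by
    refine hU.ae_eq_zero_of_integral_contDiff_smul_eq_zero
      (hf.locallyIntegrableOn hU.measurableSet) fun g hg hgs hgU => ?_
    have hgs' : HasCompactSupport fun x => (g x : ℂ) := hgs.comp_left Complex.ofReal_zero
    have hgd' : ContDiff ℝ (⊤ : ℕ∞) fun x => (g x : ℂ) := ofRealCLM.contDiff.comp hg
    have hsupp : tsupport (fun x => (g x : ℂ)) ⊆ U :=
      (tsupport_comp_subset Complex.ofReal_zero g).trans hgU
    have hint := h (hgs'.toSchwartzMap hgd') (fun x hx => hsupp hx) hgs'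
    have hI : ∀ {H : (Fin n → EuclideanSpace ℝ (Fin (d + 1))) → ℂ},
        ContinuousOn H U → Integrable fun x => H x * (g x : ℂ) :=
      fun hH => (continuous_mul_of_tsupport_subset hU hH hgd'.continuous hsupp)
        |>.integrable_of_hasCompactSupport hgs'.mul_left
    calc ∫ x, g x • (G x - G' x) = ∫ x, (G x * (g x : ℂ) - G' x * (g x : ℂ)) := by
          congr 1; funext x; rw [Complex.real_smul]; ring
      _ = (∫ x, G x * (g x : ℂ)) - ∫ x, G' x * (g x : ℂ) := integral_sub (hI hG) (hI hG')
      _ = 0 := by rw [sub_eq_zero]; exact hint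
  have hae' : (fun x => G x - G' x) =ᵐ[volume.restrict U] 0 := by
    rw [Filter.EventuallyEq, ae_restrict_iff' hU.measurableSet]
    exact hae
  intro x hx
  exact sub_eq_zero.1 (Measure.eqOn_open_of_ae_eq hae' hU hf continuousOn_const hx)

variable {S : SchwingerFamily (EuclideanSpace ℝ (Fin (d + 1)))} {𝔚 : (Fin n → Fin (d + 1) → ℂ) → ℂ}

/-- **Local Euclidean rotation invariance of the continuation at Euclidean points** (E1 read
pointwise): if `x` and its rotation `R_φ x` in the `(0, i)`-plane are both time-ordered, then
`𝔚(ι(R_φ x)) = 𝔚(ιx)`. Proof: on the open set `U = Ω_< ∩ R_φ⁻¹ Ω_<` both sides are continuous,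
and for `F` supported in `U` both `F` and `F ∘ R_φ⁻¹` are time-ordered, so
`∫ 𝔚(ι R_φ x) F(x) dx = ∫ 𝔚(ιy) F(R_φ⁻¹ y) dy = 𝔖ₙ(F ∘ R_φ⁻¹) = 𝔖ₙ(F) = ∫ 𝔚(ιx) F(x) dx`
(rotation invariance of Lebesgue measure and E1); conclude with
`eqOn_of_integral_mul_eq_of_isOpen`. [cite: OsterwalderSchraderCMP1973, §4.2] -/
theorem apply_euclideanPoint_planeRot_eq (hE1 : S.IsEuclideanCovariant)
    (h𝔚 : DifferentiableOn ℂ 𝔚 (forwardTube d n))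
    (hS : ∀ F : 𝓢((Fin n → EuclideanSpace ℝ (Fin (d + 1))), ℂ), IsTimeOrdered F →
      S n F = ∫ x, 𝔚 (euclideanPoint x) * F x)
    (i : Fin d) (φ : ℝ) {x : Fin n → EuclideanSpace ℝ (Fin (d + 1))}
    (hx : x ∈ timeOrderedRegion d n)
    (hφx : (fun k => planeRot i φ (x k)) ∈ timeOrderedRegion d n) :
    𝔚 (euclideanPoint fun k => planeRot i φ (x k)) = 𝔚 (euclideanPoint x) := by
  set L := planeRot i φ with hL
  set ρ : (Fin n → EuclideanSpace ℝ (Fin (d + 1))) → (Fin n → EuclideanSpace ℝ (Fin (d + 1))) :=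
    fun x k => L (x k) with hρ
  have hρc : Continuous ρ := continuous_pi fun k => L.continuous.comp (continuous_apply k)
  set U : Set (Fin n → EuclideanSpace ℝ (Fin (d + 1))) :=
    timeOrderedRegion d n ∩ ρ ⁻¹' timeOrderedRegion d n with hU
  have hUo : IsOpen U := isOpen_timeOrderedRegion.inter (isOpen_timeOrderedRegion.preimage hρc)
  have hcont : ContinuousOn (fun x => 𝔚 (euclideanPoint x)) (timeOrderedRegion d n) :=
    h𝔚.continuousOn.comp continuous_euclideanPoint.continuousOn
      mapsTo_euclideanPoint_timeOrderedRegion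
  have hG : ContinuousOn (fun x => 𝔚 (euclideanPoint (ρ x))) U :=
    hcont.comp hρc.continuousOn fun x hx => hx.2
  have hG' : ContinuousOn (fun x => 𝔚 (euclideanPoint x)) U := hcont.mono fun x hx => hx.1
  refine eqOn_of_integral_mul_eq_of_isOpen hUo hG hG' (fun F hFU _ => ?_) (Set.mem_inter hx hφx)
  -- `F` is supported in `U`: `F` and `F ∘ L⁻¹` are time-ordered
  have hF : IsTimeOrdered F := fun x hx => (hFU hx).1
  have hLF : IsTimeOrdered (linActMulti L F) := by
    intro y hy
    set e : (Fin n → EuclideanSpace ℝ (Fin (d + 1))) ≃ₜ (Fin n → EuclideanSpace ℝ (Fin (d + 1))) :=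
      (ContinuousLinearEquiv.piCongrRight fun _ : Fin n =>
        L.symm.toContinuousLinearEquiv).toHomeomorph
    have hcomp : ((linActMulti L F : 𝓢(_, ℂ)) : (Fin n → EuclideanSpace ℝ (Fin (d + 1))) → ℂ) =
        (F : (Fin n → EuclideanSpace ℝ (Fin (d + 1))) → ℂ) ∘ e := by
      funext y; rfl
    rw [hcomp, tsupport_comp_eq_preimage] at hy
    have hy' : ρ (e y) ∈ timeOrderedRegion d n := (hFU hy).2
    have hρe : ρ (e y) = y := funext fun k => L.apply_symm_apply (y k)
    rwa [hρe] at hy'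
  -- change of variables `y = ρ x`
  have hmp : MeasurePreserving ρ := volume_preserving_pi fun _ : Fin n => L.measurePreserving
  set em : (Fin n → EuclideanSpace ℝ (Fin (d + 1))) ≃ᵐ (Fin n → EuclideanSpace ℝ (Fin (d + 1))) :=
    (ContinuousLinearEquiv.piCongrRight fun _ : Fin n =>
      L.toContinuousLinearEquiv).toHomeomorph.toMeasurableEquiv
  have hem : MeasurePreserving em := hmp
  have hcv := hem.integral_comp' (fun y => 𝔚 (euclideanPoint y) * linActMulti L F y)
  have hem_apply : ∀ x, em x = ρ x := fun x => rfl
  calc ∫ x, 𝔚 (euclideanPoint (ρ x)) * F x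
      = ∫ x, 𝔚 (euclideanPoint (em x)) * linActMulti L F (em x) := by
        congr 1; funext x
        rw [hem_apply, linActMulti_apply]
        congr 2
        funext k
        exact (L.symm_apply_apply (x k)).symm
    _ = ∫ y, 𝔚 (euclideanPoint y) * linActMulti L F y := hcv
    _ = S n (linActMulti L F) := (hS _ hLF).symm
    _ = S n F := hE1.linActMulti n L F
    _ = ∫ x, 𝔚 (euclideanPoint x) * F x := hS F hF

/-- For a time-ordered `x`, the rotated configurations `R_φ x` are time-ordered for `φ` near `0`
(`Ω_<` is open). [folklore] -/
theorem eventually_planeRot_mem_timeOrderedRegion (i : Fin d)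
    {x : Fin n → EuclideanSpace ℝ (Fin (d + 1))} (hx : x ∈ timeOrderedRegion d n) :
    ∀ᶠ φ in 𝓝 (0 : ℝ), (fun k => planeRot i φ (x k)) ∈ timeOrderedRegion d n := by
  have hc : Continuous fun φ : ℝ => fun k => planeRot i φ (x k) := by
    refine continuous_pi fun k => ?_
    have h1 : Continuous fun φ : ℝ => (WithLp.ofLp (planeRot i φ (x k)) : Fin (d + 1) → ℝ) := by
      refine continuous_pi fun j => ?_
      simp only [planeRot_apply]
      split_ifs <;> fun_prop
    have h2 := (PiLp.continuous_toLp 2 (fun _ : Fin (d + 1) => ℝ)).comp h1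
    simp only [Function.comp_def, WithLp.toLp_ofLp] at h2
    exact h2
  refine hc.continuousAt.eventually_mem (isOpen_timeOrderedRegion.mem_nhds ?_)
  have h0 : (fun k => planeRot i 0 (x k)) = x := funext fun k => planeRot_zero_apply i (x k)
  simpa only [h0] using hx

/-- **Boosts act trivially on the continuation** (E1 via analytic continuation in the
rapidity; Osterwalder–Schrader I (1973), §4.2; Streater–Wightman (1964), §2-4): for a
time-ordered Euclidean point `z = ιx` the function `w ↦ 𝔚(B_i(w) z)` is holomorphic on a strip
`|Im w| < δ` (on which `B_i(w) z = B_i(Re w) B_i(i Im w) z ∈ 𝒯ₙ`), equals `𝔚(z)` at `w = iφ`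
for real `φ` near `0` (`boostC_mul_I_euclideanPoint`, `apply_euclideanPoint_planeRot_eq`), hence
on the whole strip by the identity theorem, in particular at real rapidities; the identity
theorem on the tube (`tubeInvariant_of_euclidean`) extends `𝔚 ∘ B_i(χ)_ℂ = 𝔚` to `𝒯ₙ`. [cite: OsterwalderSchraderCMP1973, §4.2] -/
theorem tubeInvariant_boost (hE1 : S.IsEuclideanCovariant)
    (h𝔚 : DifferentiableOn ℂ 𝔚 (forwardTube d n))
    (hS : ∀ F : 𝓢((Fin n → EuclideanSpace ℝ (Fin (d + 1))), ℂ), IsTimeOrdered F →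
      S n F = ∫ x, 𝔚 (euclideanPoint x) * F x)
    (i : Fin d) (χ : ℝ) : TubeInvariant 𝔚 (boost i χ) := by
  refine tubeInvariant_of_euclidean (boost_mem_lorentzGroup i χ) (isOrthochronous_boost i χ) h𝔚
    fun x hx => ?_
  set z : Fin n → Fin (d + 1) → ℂ := euclideanPoint x with hz_def
  have hz : z ∈ forwardTube d n := mapsTo_euclideanPoint_timeOrderedRegion hx
  set γ : ℂ → (Fin n → Fin (d + 1) → ℂ) := fun w k => boostC i w (z k) with hγ
  have hγd : Differentiable ℂ γ := differentiable_boostC_rapidity i z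
  have hγI : ∀ φ : ℝ, γ ((φ : ℂ) * I) = euclideanPoint fun k => planeRot i φ (x k) := fun φ =>
    funext fun k => boostC_mul_I_euclideanPoint i φ x k
  -- admissible imaginary rapidities near `0`
  obtain ⟨δ, hδ, hδmem⟩ : ∃ δ > 0, ∀ φ : ℝ, |φ| < δ → γ ((φ : ℂ) * I) ∈ forwardTube d n := by
    have ho : IsOpen {φ : ℝ | γ ((φ : ℂ) * I) ∈ forwardTube d n} :=
      isOpen_forwardTube.preimage (hγd.continuous.comp (continuous_ofReal.mul continuous_const))
    have h0 : (0 : ℝ) ∈ {φ : ℝ | γ ((φ : ℂ) * I) ∈ forwardTube d n} := by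
      have : γ (((0 : ℝ) : ℂ) * I) = z := by funext k; simp [hγ]
      show γ (((0 : ℝ) : ℂ) * I) ∈ forwardTube d n
      rw [this]; exact hz
    obtain ⟨δ, hδ, hball⟩ := Metric.isOpen_iff.1 ho 0 h0
    exact ⟨δ, hδ, fun φ hφ => hball (by simpa [Real.dist_eq] using hφ)⟩
  -- the strip `|Im w| < δ`
  set D : Set ℂ := {w : ℂ | -δ < w.im} ∩ {w : ℂ | w.im < δ} with hD
  have hDo : IsOpen D :=
    (isOpen_lt continuous_const Complex.continuous_im).inter
      (isOpen_lt Complex.continuous_im continuous_const)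
  have him : IsLinearMap ℝ fun w : ℂ => w.im :=
    ⟨fun u v => Complex.add_im u v, fun c u => Complex.smul_im c u⟩
  have hDc : Convex ℝ D := (convex_halfSpace_gt him _).inter (convex_halfSpace_lt him _)
  have hreal : ∀ r : ℝ, (r : ℂ) ∈ D := fun r => ⟨by simp [hδ], by simp [hδ]⟩
  have hmemD : Set.MapsTo γ D (forwardTube d n) := fun w hw => by
    have hsplit : γ w = fun k => lorentzActC (boost i w.re) (γ ((w.im : ℂ) * I) k) := by
      funext k
      simp only [hγ]
      rw [← boostC_ofReal, ← boostC_add, Complex.re_add_im]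
    rw [hsplit]
    exact lorentzActC_mem_forwardTube_of_orthochronous (boost_mem_lorentzGroup i _)
      (isOrthochronous_boost i _) (hδmem _ (abs_lt.2 ⟨hw.1, hw.2⟩))
  -- the difference `w ↦ 𝔚 (γ w) - 𝔚 z` is analytic on `D` and vanishes at `iφ`, `φ → 0⁺`
  have hφ : AnalyticOnNhd ℂ (fun w => 𝔚 (γ w) - 𝔚 z) D :=
    ((h𝔚.comp hγd.differentiableOn hmemD).sub (differentiableOn_const _)).analyticOnNhd hDo
  have hfreq : ∃ᶠ w in 𝓝[≠] (0 : ℂ), 𝔚 (γ w) - 𝔚 z = 0 := by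
    have htend : Tendsto (fun s : ℝ => (s : ℂ) * I) (𝓝[>] 0) (𝓝[≠] 0) := by
      have hc : Continuous fun s : ℝ => (s : ℂ) * I := continuous_ofReal.mul continuous_const
      have h1 : Tendsto (fun s : ℝ => (s : ℂ) * I) (𝓝[>] 0) (𝓝[{0}ᶜ] (((0 : ℝ) : ℂ) * I)) :=
        hc.continuousWithinAt.tendsto_nhdsWithin fun s hs =>
          mul_ne_zero (ofReal_ne_zero.2 (ne_of_gt hs)) I_ne_zero
      simpa using h1
    have hev : ∀ᶠ s : ℝ in 𝓝[>] 0, 𝔚 (γ ((s : ℂ) * I)) - 𝔚 z = 0 := by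
      have h := (eventually_planeRot_mem_timeOrderedRegion i hx).filter_mono
        (nhdsWithin_le_nhds (s := Set.Ioi (0 : ℝ)))
      filter_upwards [h] with s hs
      rw [hγI, apply_euclideanPoint_planeRot_eq hE1 h𝔚 hS i s hx hs, sub_self]
    exact htend.frequently hev.frequently
  have h0D : (0 : ℂ) ∈ D := by simpa using hreal 0
  have hzero := hφ.eqOn_zero_of_preconnected_of_frequently_eq_zero hDc.isPreconnected h0D hfreq
    (hreal χ)
  have hγχ : γ χ = fun k => lorentzActC (boost i χ) (z k) :=
    funext fun k => boostC_ofReal i χ (z k)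
  rw [← hγχ]
  simpa [sub_eq_zero] using hzero

end BoostInvariance


/-! ## Decomposition of orthochronous Lorentz transformations -/

section Decomposition

variable {Λ : SpaceTime d ≃L[ℝ] SpaceTime d}

/-- A Lorentz transformation fixing `e₀` preserves the time coordinate:
`(Λx)⁰ = η(Λe₀, Λx) = η(e₀, x) = x⁰`. [folklore] -/
theorem apply_zero_eq_of_apply_e₀_eq (hM : Λ ∈ lorentzGroup d) (he : Λ (e₀ d) = e₀ d)
    (x : SpaceTime d) : Λ x 0 = x 0 := by
  rw [← minkowskiForm_e₀_left (Λ x), ← he, (mem_lorentzGroup_iff Λ).1 hM, minkowskiForm_e₀_left]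

/-- **A Lorentz transformation fixing `e₀` is a spatial isometry** `1 ⊕ R`, `R ∈ O(d)`: it
preserves the time coordinate, hence maps `{0} × ℝ^d` to itself preserving `−η = ⟪·,·⟫` there
(Streater–Wightman (1964), §1-3). [cite: StreaterWightman1964, §1-3] -/
theorem exists_eq_spatialRotation_of_apply_e₀_eq (hM : Λ ∈ lorentzGroup d) (he : Λ (e₀ d) = e₀ d) :
    ∃ R : EuclideanSpace ℝ (Fin d) ≃ₗᵢ[ℝ] EuclideanSpace ℝ (Fin d),
      Λ = spatialRotation R.toContinuousLinearEquiv := by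
  have h0 := apply_zero_eq_of_apply_e₀_eq hM he
  have hadd : ∀ v w : EuclideanSpace ℝ (Fin d),
      (ofTimeSpace 0 (v + w) : SpaceTime d) = ofTimeSpace 0 v + ofTimeSpace 0 w := fun v w => by
    ext j; refine Fin.cases ?_ (fun k => ?_) j <;> simp
  have hsmul : ∀ (c : ℝ) (v : EuclideanSpace ℝ (Fin d)),
      (ofTimeSpace 0 (c • v) : SpaceTime d) = c • ofTimeSpace 0 v := fun c v => by
    ext j; refine Fin.cases ?_ (fun k => ?_) j <;> simp
  -- the spatial block of `Λ`
  let R₀ : EuclideanSpace ℝ (Fin d) →ₗ[ℝ] EuclideanSpace ℝ (Fin d) :=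
    { toFun := fun v => spaceC d (Λ (ofTimeSpace 0 v))
      map_add' := fun v w => by rw [hadd, map_add, map_add]
      map_smul' := fun c v => by rw [hsmul, map_smul, map_smul, RingHom.id_apply] }
  have hR₀ : ∀ v, R₀ v = spaceC d (Λ (ofTimeSpace 0 v)) := fun v => rfl
  have hnorm : ∀ v, ‖R₀ v‖ = ‖v‖ := fun v => by
    have h1 : Λ (ofTimeSpace 0 v) 0 = 0 := by rw [h0]; rfl
    have h2 := minkowskiForm_self (Λ (ofTimeSpace 0 v))
    rw [(mem_lorentzGroup_iff Λ).1 hM, minkowskiForm_self, ofTimeSpace_apply_zero,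
      spaceC_ofTimeSpace, h1, ← hR₀] at h2
    have hsq : ‖R₀ v‖ ^ 2 = ‖v‖ ^ 2 := by linarith
    exact (sq_eq_sq₀ (norm_nonneg _) (norm_nonneg _)).1 hsq
  let Rli : EuclideanSpace ℝ (Fin d) →ₗᵢ[ℝ] EuclideanSpace ℝ (Fin d) := ⟨R₀, hnorm⟩
  let R : EuclideanSpace ℝ (Fin d) ≃ₗᵢ[ℝ] EuclideanSpace ℝ (Fin d) := Rli.toLinearIsometryEquiv rfl
  have hR : ∀ v, R v = spaceC d (Λ (ofTimeSpace 0 v)) := fun v => by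
    rw [← hR₀]
    simp [R, Rli]
  refine ⟨R, ContinuousLinearEquiv.ext (funext fun x => ?_)⟩
  have hx : x = (x 0) • e₀ d + ofTimeSpace 0 (spaceC d x) := by
    ext j; refine Fin.cases ?_ (fun k => ?_) j <;> simp [Fin.succ_ne_zero]
  conv_lhs => rw [hx]
  rw [map_add, map_smul, he, spatialRotation_apply]
  ext j
  refine Fin.cases ?_ (fun k => ?_) j
  · simp [h0]
  · simp [hR, Fin.succ_ne_zero]

/-- `B_i(χ) e₀ = (cosh χ, sinh χ eᵢ)`. [folklore] -/
theorem boost_apply_e₀ (i : Fin d) (χ : ℝ) :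
    boost i χ (e₀ d) = ofTimeSpace (Real.cosh χ) (Real.sinh χ • EuclideanSpace.single i (1 : ℝ)) := by
  ext j
  refine Fin.cases ?_ (fun k => ?_) j
  · simp [boostLin_apply, Fin.succ_ne_zero]
  · by_cases hk : k = i
    · subst hk; simp [boostLin_apply, Fin.succ_ne_zero]
    · have hne : (k.succ : Fin (d + 1)) ≠ i.succ := fun h => hk (Fin.succ_injective _ h)
      simp [boostLin_apply, Fin.succ_ne_zero, hne, hk]

/-- **Every future unit timelike vector `Λe₀` is `(1 ⊕ R) B_i(χ) e₀`** with `R ∈ O(d)` the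
reflection taking `‖u⃗‖ eᵢ` to the spatial part `u⃗` of `u = Λe₀` (Mathlib
`Submodule.reflection_sub`) and `χ = arsinh ‖u⃗‖` (`u⁰ = √(1 + ‖u⃗‖²)` by `η(u,u) = 1`, `u⁰ > 0`). [folklore] -/
theorem exists_spatialRotation_boost_apply_e₀ (hΛ : Λ ∈ lorentzGroup d) (ho : IsOrthochronous Λ)
    (i : Fin d) :
    ∃ (R : EuclideanSpace ℝ (Fin d) ≃ₗᵢ[ℝ] EuclideanSpace ℝ (Fin d)) (χ : ℝ),
      spatialRotation R.toContinuousLinearEquiv (boost i χ (e₀ d)) = Λ (e₀ d) := by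
  set u := Λ (e₀ d) with hu
  set us : EuclideanSpace ℝ (Fin d) := spaceC d u with hus
  set v : EuclideanSpace ℝ (Fin d) := ‖us‖ • EuclideanSpace.single i (1 : ℝ) with hv_def
  have hv : ‖v‖ = ‖us‖ := by simp [hv_def, norm_smul]
  have hRv : (ℝ ∙ (v - us))ᗮ.reflection v = us := Submodule.reflection_sub hv
  have hu0 : u 0 = Real.sqrt (1 + ‖us‖ ^ 2) := by
    have h1 : minkowskiForm d u u = 1 := by
      rw [hu, (mem_lorentzGroup_iff Λ).1 hΛ]; exact minkowskiForm_e₀_e₀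
    rw [minkowskiForm_self] at h1
    have hpos : 0 < u 0 := ho
    rw [← Real.sqrt_sq hpos.le]
    congr 1
    linarith
  refine ⟨(ℝ ∙ (v - us))ᗮ.reflection, Real.arsinh ‖us‖, ?_⟩
  rw [boost_apply_e₀, spatialRotation_apply, Real.cosh_arsinh, Real.sinh_arsinh]
  simp only [timeC_apply, ofTimeSpace_apply_zero, spaceC_ofTimeSpace,
    LinearIsometryEquiv.coe_toContinuousLinearEquiv]
  rw [← hv_def, hRv, ← hu0, hus]
  exact ofTimeSpace_apply_zero_spaceC u

/-- **Decomposition of orthochronous Lorentz transformations**: `Λ = (1 ⊕ R₁) B_i(χ) (1 ⊕ R₂)`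
with `R₁, R₂ ∈ O(d)` (Streater–Wightman (1964), §1-3: boost to the rest frame of `Λe₀`, the
remainder fixes `e₀`). [cite: StreaterWightman1964, §1-3] -/
theorem exists_eq_spatialRotation_mul_boost_mul (hΛ : Λ ∈ lorentzGroup d) (ho : IsOrthochronous Λ)
    (i : Fin d) :
    ∃ (R₁ R₂ : EuclideanSpace ℝ (Fin d) ≃ₗᵢ[ℝ] EuclideanSpace ℝ (Fin d)) (χ : ℝ),
      Λ = spatialRotation R₁.toContinuousLinearEquiv * boost i χ *
        spatialRotation R₂.toContinuousLinearEquiv := by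
  obtain ⟨R₁, χ, h₁⟩ := exists_spatialRotation_boost_apply_e₀ hΛ ho i
  set P := spatialRotation R₁.toContinuousLinearEquiv * boost i χ with hP
  have hPmem : P ∈ lorentzGroup d :=
    (lorentzGroup d).mul_mem (spatialRotation_mem_lorentzGroup R₁) (boost_mem_lorentzGroup i χ)
  have hPe : P (e₀ d) = Λ (e₀ d) := by rw [hP, continuousLinearEquiv_mul_apply]; exact h₁
  have hM : P⁻¹ * Λ ∈ lorentzGroup d :=
    (lorentzGroup d).mul_mem ((lorentzGroup d).inv_mem hPmem) hΛ
  have hMe : (P⁻¹ * Λ) (e₀ d) = e₀ d := by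
    rw [continuousLinearEquiv_mul_apply, ← hPe]
    exact continuousLinearEquiv_inv_apply_apply P (e₀ d)
  obtain ⟨R₂, hR₂⟩ := exists_eq_spatialRotation_of_apply_e₀_eq hM hMe
  exact ⟨R₁, R₂, χ, by rw [← hR₂, ← hP, mul_inv_cancel_left]⟩

end Decomposition


/-! ## Lorentz invariance of the continuation and of its boundary values -/

section LorentzInvariance

variable {S : SchwingerFamily (EuclideanSpace ℝ (Fin (d + 1)))} {𝔚 : (Fin n → Fin (d + 1) → ℂ) → ℂ}
  {Λ : SpaceTime d ≃L[ℝ] SpaceTime d}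

/-- **The OS continuation is invariant under the orthochronous Lorentz group** (`d ≥ 1`):
spatial isometries and boosts act trivially (`tubeInvariant_spatialRotation`,
`tubeInvariant_boost`) and generate (`exists_eq_spatialRotation_mul_boost_mul`). [cite: OsterwalderSchraderCMP1973, §4.2] -/
theorem tubeInvariant_of_orthochronous [NeZero d] (hE1 : S.IsEuclideanCovariant)
    (h𝔚 : DifferentiableOn ℂ 𝔚 (forwardTube d n))
    (hS : ∀ F : 𝓢((Fin n → EuclideanSpace ℝ (Fin (d + 1))), ℂ), IsTimeOrdered F →
      S n F = ∫ x, 𝔚 (euclideanPoint x) * F x)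
    (hΛ : Λ ∈ lorentzGroup d) (ho : IsOrthochronous Λ) : TubeInvariant 𝔚 Λ := by
  obtain ⟨R₁, R₂, χ, rfl⟩ := exists_eq_spatialRotation_mul_boost_mul hΛ ho
    (⟨0, Nat.pos_of_ne_zero (NeZero.ne d)⟩ : Fin d)
  exact ((tubeInvariant_spatialRotation hE1 h𝔚 hS R₁).mul (tubeInvariant_boost hE1 h𝔚 hS _ χ)
      (boost_mem_lorentzGroup _ χ) (isOrthochronous_boost _ χ)).mul
    (tubeInvariant_spatialRotation hE1 h𝔚 hS R₂) (spatialRotation_mem_lorentzGroup R₂)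
    (isOrthochronous_spatialRotation _)

/-- **Lorentz invariance of the OS boundary values** (Osterwalder–Schrader I (1973), §4.2, R1
from E1): if `𝔖ₙ` is Euclidean covariant and `𝔚` is holomorphic on `𝒯ₙ` with Euclidean
restriction `𝔖ₙ` on `𝒮_<` and distributional boundary value `T`, then `T(F ∘ Λ⁻¹) = T(F)` for
every orthochronous Lorentz transformation `Λ` (witness form). [cite: OsterwalderSchraderCMP1973, §4.2] -/
theorem _root_.Literature.MathematicalPhysics.QuantumLattice.HasDistributionalBoundaryValue.lorentz_eq [NeZero d] (hE1 : S.IsEuclideanCovariant)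
    (h𝔚 : DifferentiableOn ℂ 𝔚 (forwardTube d n)) {T : 𝓢((Fin n → SpaceTime d), ℂ) →L[ℂ] ℂ}
    (hT : HasDistributionalBoundaryValue 𝔚 T)
    (hS : ∀ F : 𝓢((Fin n → EuclideanSpace ℝ (Fin (d + 1))), ℂ), IsTimeOrdered F →
      S n F = ∫ x, 𝔚 (euclideanPoint x) * F x)
    (hΛ : Λ ∈ lorentzGroup d) (ho : IsOrthochronous Λ) {F G : 𝓢((Fin n → SpaceTime d), ℂ)}
    (hG : ∀ x, G x = F fun k => Λ.symm (x k)) : T G = T F :=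
  hT.apply_eq_of_tubeInvariant hΛ ho (tubeInvariant_of_orthochronous hE1 h𝔚 hS hΛ ho) hG

/-- **Invariance of the OS boundary values under the restricted Lorentz group** in the form used
by `IsPoincareInvariantFamily`: `T (poincareTestMulti n (0, Λ) F) = T F` for `Λ ∈ L↑₊`. [cite: OsterwalderSchraderCMP1973, §4.2] -/
theorem _root_.Literature.MathematicalPhysics.QuantumLattice.HasDistributionalBoundaryValue.poincareTestMulti_inr_eq [NeZero d]
    (hE1 : S.IsEuclideanCovariant) (h𝔚 : DifferentiableOn ℂ 𝔚 (forwardTube d n))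
    {T : 𝓢((Fin n → SpaceTime d), ℂ) →L[ℂ] ℂ} (hT : HasDistributionalBoundaryValue 𝔚 T)
    (hS : ∀ F : 𝓢((Fin n → EuclideanSpace ℝ (Fin (d + 1))), ℂ), IsTimeOrdered F →
      S n F = ∫ x, 𝔚 (euclideanPoint x) * F x)
    (Λ : restrictedLorentzGroup d) (F : 𝓢((Fin n → SpaceTime d), ℂ)) :
    T (poincareTestMulti n (SemidirectProduct.inr Λ) F) = T F :=
  have hm := (mem_restrictedLorentzGroup_iff _).1 Λ.2
  hT.lorentz_eq hE1 h𝔚 hS hm.1 hm.2.1 fun x => by simp [poincareTestMulti_apply]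

end LorentzInvariance

end Literature.MathematicalPhysics.QuantumFieldTheory
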